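import Literature.AlgebraicGeometry.ModuliOfAbelianVarieties.SiegelModuliThickPoints
import Summits.HodgeConjecture.HodgeConjecture.Theorems.UeP4OfFPiece
import Summits.HodgeConjecture.HodgeConjecture.Theorems.SiegelUniversalFamilyHodgeFrames
import Summits.HodgeConjecture.HodgeConjecture.Theorems.UHeadGlueClassMap
import Summits.HodgeConjecture.CorCM.HypDel.M1primeOfFU
import Literature.AlgebraicGeometry.ModuliOfAbelianVarieties.SiegelFineModuliFibreTriples
import Literature.AlgebraicGeometry.ModuliOfAbelianVarieties.SiegelModuliRelation
import Literature.AlgebraicGeometry.Motives.ComplexPointsManifold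
import Literature.AlgebraicGeometry.Motives.UniversalHypersurfaceQuasiProjective
import Literature.NumberTheory.ModularForms.SiegelSymplecticVolume
import Literature.NumberTheory.ModularForms.SiegelUpperHalfSpaceProperAction
import Literature.NumberTheory.Transcendental.Analytification
import Mathlib.Topology.Baire.Lemmas
import Mathlib.Topology.Baire.LocallyCompactRegular
import HarnessLib

/-!
# E-road (T2): THICKNESS TRANSFERS FORWARD along period-compatible continuous maps of complex points

Cell hodgecm-mathlib (D-0151), E-road «EQUIDIM by proof», Hecke-link line card v1.1 — the ANALYTIC half of the road to
`stub_noThinPiece`: given socket (A) (a THICK Hecke-linked point upstairs) and socket (B) (the isogeny-quotient map `Φ`, `Φ s′ = x`,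
open `θ`, period compatibility at one representative), thickness passes to `x`.  TREE EDITION of B-p01 (g13)'s HOME cert v9 §T2 with
the P4-piece socket DISCHARGED (`hP4` ↦ ★ `UeP4OfFPiece.ue_P4_piece_of_F hF`).  THEOREMS ONLY, `--as helper` capital for
`stmt-HodgeConjecture-24835` (count-neutral).  HC_CM is proved only modulo the 7 printed citations until rung 0 closes.

## The mathematics ([LangeBirkenhake1992] Ch. 8 §8.1; [Lange2023AbelianVarietiesComplex] §3.1.2)

Let `𝓜′` (type `δ′`, level `N′`) and `𝓜` (type `δ`, level `N ≥ 3`) be Siegel fine moduli schemes ((F)), `ι′ : S″ ⟶ 𝓜′_ℂ` a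
morphism from a `ℂ`-scheme smooth of relative dimension `d″`, THICK at the complex point `s₀` with respect to a representative
`r′` (★ `EquidimOfF.IsThickAtWith`), `Φ : S″(ℂ) → 𝓜_ℂ(ℂ)` CONTINUOUS, `θ : 𝔥_g → 𝔥_g` an OPEN map, `r ∈ K_δ(1)`, such that
admissibility of fibre triples is carried from `(ι′ s, Z, r′)` to `(Φ s, θ Z, r)` for every complex point `s` of `S″`.  Then every
smooth open piece `ι : S′ ⟶ 𝓜_ℂ` through `Φ s₀` is THICK there (`isThickAt_of_periodCompatible_of_continuous`; morphism form
`isThickAt_of_periodCompatible` for `Φ = AlgPoints.map φ`).  Proof: at scale `O ∋ t` take a compact chart-ball `K ⊆ W ∩ chart.source ∩ O`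
around `t` (★ `ComplexPoints.algebraicChart`, P4-piece period map `π` on `W`); continuity of `Φ` and openness of `ι(K°)` (★
`AlgPoints.isOpenEmbedding_map_holds`) give an open `D ∋ s₀` mapped into `ι(K°)`; thickness at scale `D` gives an open `V′ ⊆ 𝔥_g` of
periods of points of `D`; for each such period `z′` the two admissibilities at `θ z′` and at `π x` of ONE classifying point force
`π x ∈ Γ_δ(N) • θ z′` (★ `UHead.classifyingMap_eq_iff_rel` + ★ `rel_iff_exists_smul`); so the open `θ(V′)` is covered by countably
many closed translates `γ⁻¹ • π(K)` (★ `instContinuousSMul`), and BAIRE in the locally compact `𝔥_g` (★ `instLocallyCompactSpace`)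
yields a translate — hence `π(K)` itself — with non-empty interior.

## References
* [LangeBirkenhake1992] H. Lange, Ch. Birkenhake, *Complex Abelian Varieties* (1992), Ch. 8 §8.1.
* [Lange2023AbelianVarietiesComplex] H. Lange, *Abelian Varieties over the Complex Numbers* (2023), §3.1.2 Prop. 3.1.4.
* [MumfordFogartyKirwan1994] GIT 3rd ed., App. 7A (p. 235).
-/

set_option autoImplicit false
set_option linter.dupNamespace false  -- `Summit.HodgeConjecture.HodgeConjecture.…` is the cell's layout (D-0017)

noncomputable section

open CategoryTheory CategoryTheory.Limits AlgebraicGeometry Matrix Topology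
open Literature.AlgebraicGeometry
open Literature.AlgebraicGeometry.Motives (SchemeOver ComplexPoints AlgPoints specOver)
open Literature.AlgebraicGeometry.AbelianSchemes (PolarizedAbelianSchemeWithLevel)
open Literature.AlgebraicGeometry.ModuliOfAbelianVarieties
open Literature.AlgebraicGeometry.ModuliOfAbelianVarieties.EquidimOfF
open Literature.NumberTheory.Automorphic (siegelUpperHalfSpace)
open Literature.NumberTheory.Adeles
open Literature.NumberTheory.ModularForms Literature.NumberTheory.ModularForms.SiegelUpperHalfSpace
open scoped Pointwise

namespace Summit.HodgeConjecture.HodgeConjecture.Theorems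

namespace EquidimThickTransfer

open SiegelModuli

variable {g N N' : ℕ} {δ δ' : Fin g → ℕ}

/-- Transport of admissibility along an equality of period points (proof-irrelevance helper).
[cite: LangeBirkenhake1992, Ch. 8 §8.1] -/
private theorem isAdmissibleAt_congr {hδ : IsPolarizationType δ} {r : gspFinAdelic δ}
    {Z Z' : Matrix (Fin g) (Fin g) ℂ} (h : Z = Z') (hZ : Z ∈ siegelUpperHalfSpace g)
    (hZ' : Z' ∈ siegelUpperHalfSpace g) (P : PolarizedAbelianSchemeWithLevel g N δ (specOver ℚ ℂ).left) :
    IsAdmissibleAt hδ r Z' hZ' P → IsAdmissibleAt hδ r Z hZ P := by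
  subst h
  exact id

/-- **(T2, topological form) THICKNESS TRANSFERS FORWARD ALONG PERIOD-COMPATIBLE CONTINUOUS MAPS OF COMPLEX POINTS** —
as `isThickAt_of_periodCompatible` below, but `Φ : S″(ℂ) → 𝓜_ℂ(ℂ)` is ANY continuous map (the proof of the morphism form uses
only continuity of `AlgPoints.map φ`; B-plan1 (g14) line card v1, kill-list (ii)).  **(T2) THICKNESS TRANSFERS FORWARD.**  Let `𝓜′` (type `δ′`, level `N′`) and `𝓜`
(type `δ`, level `N ≥ 3`) be Siegel fine moduli schemes, `ι′ : S″ ⟶ 𝓜′_ℂ` a smooth open piece THICK at the complex point `s₀`,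
`φ : S″ ⟶ 𝓜_ℂ` ANY morphism of `ℂ`-schemes (the instance is the isogeny-quotient map of the Hecke link; neither open, nor
étale, nor injective is assumed) and `θ : 𝔥_g → 𝔥_g` an OPEN map (continuity not needed; instance: `Z ↦ h • Z`, `h ∈ GSp⁺(ℚ)`) such that
admissibility of the fibre triples is carried from `(ι′ s, Z)` (any principal `r′`) to `(φ s, θ Z)` at the fixed principal
`r`.  Then every smooth open piece `ι : S′ ⟶ 𝓜_ℂ` through `φ s₀` is THICK there (hence NOT THIN: `le_of_isThickAt`).
Proof: at scale `O ∋ t` take a compact chart-ball `K ⊆ W ∩ chart.source ∩ O` around `t`; continuity of `φ` on complex points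
and openness of `ι(K°)` (★ `AlgPoints.isOpenEmbedding_map_holds`) give an open `D ∋ s₀` mapped into `ι(K°)`; thickness of
`S″` at scale `D` gives an open `V′ ⊆ 𝔥_g` of periods of points of `D`; for each such period `z′` the two admissibilities at
`θ z′` (compatibility) and at `π x` (P4-piece reading, `x ∈ K`) of ONE classifying point force `π x ∈ Γ_δ(N) • θ z′`
(★ `UHead.classifyingMap_eq_iff_rel` + ★ `rel_iff_exists_smul`); so the open `θ(V′)` is covered by the countably many closed
translates `γ⁻¹ • {w | w ∈ π(K)}` (`Sp_δ(ℤ)` countable, the action continuous ★ `instContinuousSMul`), and BAIRE in the locally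
compact `𝔥_g` (★ `instLocallyCompactSpace`) yields a translate — hence `π(K)` itself — with non-empty interior in `𝔥_g`.
[cite: LangeBirkenhake1992, Ch. 8 §8.1] [cite: Lange2023AbelianVarietiesComplex, §3.1.2 Prop. 3.1.4] -/
theorem isThickAt_of_periodCompatible_of_continuous (hF : lan2013_siegelFineModuliScheme)
    (hg : 0 < g) (hδ : IsPolarizationType δ) (hN : 3 ≤ N) (hδ' : IsPolarizationType δ')
    (𝓜 : SiegelFineModuliScheme g N δ) (𝓜' : SiegelFineModuliScheme g N' δ')
    -- the source piece, thick at `s₀`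
    {S'' : SchemeOver ℂ} (ι' : S'' ⟶ (Motives.baseChange ℚ ℂ).obj 𝓜'.M)
    (d'' : ℕ) [SmoothOfRelativeDimension d'' S''.hom] (s₀ : ComplexPoints S'')
    -- the source piece is thick at `s₀` WITH RESPECT TO the representative `r′` (fixed, B-p03 (g15) sockets-first finding;
    -- NO principal-ness of `r′` is needed for the transfer — only `r ∈ K_δ(1)` on the target side)
    (r' : gspFinAdelic δ') (hthick : IsThickAtWith hδ' 𝓜' ι' d'' s₀ r')
    -- the continuous map of complex points and the period compatibility `(ι′ s, Z, r′) ↦ (Φ s, θ Z, r)`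
    (Φ : ComplexPoints S'' → ComplexPoints ((Motives.baseChange ℚ ℂ).obj 𝓜.M)) (hΦ : Continuous Φ)
    (θ : siegelUpperHalfSpace g → siegelUpperHalfSpace g) (hθo : IsOpenMap θ)
    (r : gspFinAdelic δ) (hr : r ∈ principalLevelSubgroup δ 1)
    (hcompat :
      haveI : IsLocallyNoetherian (specOver ℚ ℂ).left := inferInstanceAs (IsLocallyNoetherian (Spec (CommRingCat.of ℂ)))
      ∀ (s : ComplexPoints S'') (Z : siegelUpperHalfSpace g)
        (P' : PolarizedAbelianSchemeWithLevel g N' δ' (specOver ℚ ℂ).left),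
        IsAdmissibleAt hδ' r' Z.1 Z.2 P' →
        AlgPoints.baseChangeEquiv (algebraMap ℚ ℂ) 𝓜'.M (𝓜'.classifyingMap (specOver ℚ ℂ) P') = AlgPoints.map (L := ℂ) ι' s →
        ∃ P : PolarizedAbelianSchemeWithLevel g N δ (specOver ℚ ℂ).left,
          IsAdmissibleAt hδ r (θ Z).1 (θ Z).2 P ∧
          AlgPoints.baseChangeEquiv (algebraMap ℚ ℂ) 𝓜.M (𝓜.classifyingMap (specOver ℚ ℂ) P) = Φ s)
    -- the target piece through `φ s₀`
    {S' : SchemeOver ℂ} (ι : S' ⟶ (Motives.baseChange ℚ ℂ).obj 𝓜.M) [IsOpenImmersion ι.left]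
    (d : ℕ) [SmoothOfRelativeDimension d S'.hom] (t : ComplexPoints S')
    (ht : AlgPoints.map (L := ℂ) ι t = Φ s₀) :
    IsThickAt hδ 𝓜 ι d t := by
  classical
  haveI hLN : IsLocallyNoetherian (specOver ℚ ℂ).left :=
    inferInstanceAs (IsLocallyNoetherian (Spec (CommRingCat.of ℂ)))
  haveI : Smooth S'.hom := SmoothOfRelativeDimension.smooth d _
  haveI : LocallyOfFiniteType S'.hom := inferInstance
  haveI : Smooth S''.hom := SmoothOfRelativeDimension.smooth d'' _
  haveI : LocallyOfFiniteType S''.hom := inferInstance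
  have hδpos : ∀ i, 0 < δ i := hδ.1
  -- quasi-projectivity of the target piece, from (F)
  obtain ⟨-, hMq, -⟩ := W1.smooth_qproj_of_F hF hg hδ hN 𝓜
  have hSq : HodgeTheory.IsQuasiProjectiveOver S' :=
    HodgeTheory.IsQuasiProjectiveOver.of_isOpenImmersion ι
      (Summit.HodgeConjecture.HodgeConjecture.Theorems.UnivFamilyHodgeFrames.isQuasiProjectiveOver_baseChange_M 𝓜 hMq)
  -- the source thickness data
  obtain ⟨W', π', hW'o, hs₀W', hπ'c, -, hread', hsc'⟩ := hthick
  -- the triple at the target point: the compatible image of the source reading at `s₀`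
  obtain ⟨hs₀Z, P'₀, hadm'₀, hcls'₀⟩ := hread' s₀ hs₀W'
  obtain ⟨P₀, hadm₀, hcls₀⟩ := hcompat s₀ ⟨π' s₀, hs₀Z⟩ P'₀ hadm'₀ hcls'₀
  -- the P4-piece period map of the TARGET piece at `t`
  obtain ⟨W, π, hWo, htW, -, hπc, hπhol, hread⟩ :=
    UeP4OfFPiece.ue_P4_piece_of_F hF g N δ hg hδ hN 𝓜 r ι hSq d hr (θ ⟨π' s₀, hs₀Z⟩).1 (θ ⟨π' s₀, hs₀Z⟩).2 P₀ hadm₀ t (ht.trans hcls₀.symm)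
  refine ⟨r, hr, W, π, hWo, htW, hπc, hπhol, hread, fun O hOo htO ↦ ?_⟩
  -- a compact chart ball `K` around `t` inside `W ∩ e.source ∩ O`
  let e := ComplexPoints.algebraicChart S' d t
  have hte : t ∈ e.source := ComplexPoints.mem_algebraicChart_source S' d t
  have hA : IsOpen (e '' (W ∩ e.source ∩ O)) := by
    refine e.isOpen_image_of_subset_source ((hWo.inter e.open_source).inter hOo) ?_
    exact fun x hx ↦ hx.1.2
  have hetA : e t ∈ e '' (W ∩ e.source ∩ O) := ⟨t, ⟨⟨htW, hte⟩, htO⟩, rfl⟩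
  obtain ⟨ε, hε, hball⟩ := Metric.isOpen_iff.1 hA (e t) hetA
  let B : Set (Fin d → ℂ) := Metric.closedBall (e t) (ε / 2)
  have hBA : B ⊆ e '' (W ∩ e.source ∩ O) :=
    (Metric.closedBall_subset_ball (by linarith)).trans hball
  have hBtgt : B ⊆ e.target := fun v hv ↦ by
    obtain ⟨x, hx, rfl⟩ := hBA hv
    exact e.map_source hx.1.2
  let K : Set (ComplexPoints S') := e.symm '' B
  have hKc : IsCompact K := (isCompact_closedBall (e t) (ε / 2)).image_of_continuousOn (e.continuousOn_symm.mono hBtgt)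
  have hKsub : K ⊆ W ∩ e.source ∩ O := by
    rintro _ ⟨v, hv, rfl⟩
    obtain ⟨x, hx, hxv⟩ := hBA hv
    rw [← hxv, e.left_inv hx.1.2]
    exact hx
  -- the open `K° ⊇ e.symm '' ball` and the open `D ∋ s₀` of the source mapped into `ι(K°)`
  let Bo : Set (Fin d → ℂ) := Metric.ball (e t) (ε / 2)
  have hBo : IsOpen (e.symm '' Bo) :=
    e.symm.isOpen_image_of_subset_source Metric.isOpen_ball
      (fun v hv ↦ hBtgt (Metric.ball_subset_closedBall hv))
  have hBoK : e.symm '' Bo ⊆ K := Set.image_mono Metric.ball_subset_closedBall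
  have htBo : t ∈ e.symm '' Bo := ⟨e t, Metric.mem_ball_self (by linarith), e.left_inv hte⟩
  have hιemb : IsOpenEmbedding (AlgPoints.map (L := ℂ) ι) :=
    Literature.AlgebraicGeometry.Motives.AlgPoints.isOpenEmbedding_map_holds ι
  let D : Set (ComplexPoints S'') := Φ ⁻¹' (AlgPoints.map (L := ℂ) ι '' (e.symm '' Bo))
  have hDo : IsOpen D := (hιemb.isOpenMap _ hBo).preimage hΦ
  have hs₀D : s₀ ∈ D := by
    show Φ s₀ ∈ AlgPoints.map (L := ℂ) ι '' (e.symm '' Bo)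
    rw [← ht]
    exact ⟨t, htBo, rfl⟩
  -- source thickness at scale `D`
  obtain ⟨V', hV'o, hV'ne, hV'sub⟩ := hsc' D hDo hs₀D
  -- the closed set `T = {w ∈ 𝔥_g | w ∈ π(K)}` and its countably many translates
  let T : Set (siegelUpperHalfSpace g) := {w | (w : Matrix (Fin g) (Fin g) ℂ) ∈ π '' K}
  have hπK : IsCompact (π '' K) := hKc.image_of_continuousOn (hπc.mono fun x hx ↦ (hKsub hx).1.1)
  have hTc : IsClosed T := hπK.isClosed.preimage continuous_subtype_val
  haveI : Countable (Matrix (Fin g ⊕ Fin g) (Fin g ⊕ Fin g) ℤ) := by unfold Matrix; infer_instance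
  haveI : Countable (GL (Fin g ⊕ Fin g) ℤ) := Function.Injective.countable Units.val_injective
  haveI : Countable (symplecticLatticeGroup δ) := by infer_instance
  let Uo : Set (siegelUpperHalfSpace g) := θ '' V'
  have hUo : IsOpen Uo := hθo _ hV'o
  have hUone : Uo.Nonempty := hV'ne.image θ
  let F : symplecticLatticeGroup δ → Set (siegelUpperHalfSpace g) :=
    fun M ↦ ((gDHom δ hδpos M)⁻¹ • T) ∪ Uoᶜ
  have hFc : ∀ M, IsClosed (F M) := fun M ↦ by
    refine IsClosed.union ?_ hUo.isClosed_compl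
    rw [← Set.image_smul]
    exact ((Homeomorph.smul ((gDHom δ hδpos M)⁻¹)).isClosed_image).2 hTc
  -- the cover: every point of `θ(V′)` lies in some translate (P6 + Prop. 3.1.4)
  have hcover : (⋃ M, F M) = Set.univ := by
    refine Set.eq_univ_of_forall fun w ↦ ?_
    by_cases hw : w ∈ Uo
    · obtain ⟨z', hz'V', rfl⟩ := hw
      -- `z′` is the period of a point `s ∈ W′ ∩ e′.source ∩ D`
      obtain ⟨s, ⟨⟨hsW', -⟩, hsD⟩, hs⟩ := hV'sub ⟨z', hz'V', rfl⟩
      obtain ⟨hsZ, P's, hadm's, hcls's⟩ := hread' s hsW'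
      have hadm's' : IsAdmissibleAt hδ' r' (z' : Matrix (Fin g) (Fin g) ℂ) z'.2 P's :=
        isAdmissibleAt_congr hs.symm z'.2 hsZ P's hadm's
      obtain ⟨P, hPadm, hPcls⟩ := hcompat s z' P's hadm's' hcls's
      -- `Φ s = ι x` with `x ∈ K`
      obtain ⟨x, hxBo, hx⟩ := hsD
      have hxK : x ∈ K := hBoK hxBo
      obtain ⟨hxZ, Q, hQadm, hQcls⟩ := hread x (hKsub hxK).1.1
      have hclsQP : 𝓜.classifyingMap (specOver ℚ ℂ) P = 𝓜.classifyingMap (specOver ℚ ℂ) Q :=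
        (AlgPoints.baseChangeEquiv (algebraMap ℚ ℂ) 𝓜.M).injective (by rw [hPcls, hQcls, hx])
      obtain ⟨M₀, hM₀, C, hC⟩ :=
        (Summit.HodgeConjecture.CorCM.HypDel.UHead.classifyingMap_eq_iff_rel hg hδ hN 𝓜 hr (θ z').2 hxZ
          hPadm hQadm).1 hclsQP
      obtain ⟨M, -, hM⟩ := (rel_iff_exists_smul hδpos (siegelLevelGroup_le_symplecticLatticeGroup δ N) (θ z').2 hxZ).1
        ⟨M₀, hM₀, C, hC⟩
      refine Set.mem_iUnion.2 ⟨M, Or.inl ?_⟩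
      rw [Set.mem_smul_set_iff_inv_smul_mem, inv_inv]
      have hθz : (⟨(θ z' : Matrix (Fin g) (Fin g) ℂ), (θ z').2⟩ : siegelUpperHalfSpace g) = θ z' := Subtype.ext rfl
      rw [hθz] at hM
      rw [← hM]
      exact ⟨x, hxK, rfl⟩
    · haveI : Nonempty (symplecticLatticeGroup δ) := ⟨1⟩
      exact Set.mem_iUnion.2 ⟨Classical.arbitrary _, Or.inr hw⟩
  -- BAIRE in the locally compact `𝔥_g`
  have hdense := dense_iUnion_interior_of_closed hFc hcover
  obtain ⟨w, hwUo, hwint⟩ := hdense.inter_open_nonempty Uo hUo hUone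
  obtain ⟨M, hwM⟩ := Set.mem_iUnion.1 hwint
  -- `w ∈ interior (F M) ∩ Uo` ⇒ `w ∈ interior (translate of T)`
  have hwint' : w ∈ interior ((gDHom δ hδpos M)⁻¹ • T) := by
    rw [mem_interior_iff_mem_nhds] at hwM ⊢
    have h2 : Uo ∈ 𝓝 w := hUo.mem_nhds hwUo
    filter_upwards [hwM, h2] with u hu huU
    exact hu.resolve_right (fun h ↦ h huU)
  -- hence `T` has non-empty interior
  have hTint : (interior T).Nonempty := by
    have himg : interior ((gDHom δ hδpos M)⁻¹ • T) =
        (Homeomorph.smul ((gDHom δ hδpos M)⁻¹)) '' interior T := by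
      rw [← Set.image_smul]
      exact ((Homeomorph.smul ((gDHom δ hδpos M)⁻¹)).image_interior T).symm
    rw [himg] at hwint'
    obtain ⟨w₀, hw₀, -⟩ := hwint'
    exact ⟨w₀, hw₀⟩
  refine ⟨interior T, isOpen_interior, hTint, ?_⟩
  rintro _ ⟨z, hz, rfl⟩
  obtain ⟨x, hxK, hxz⟩ := interior_subset hz
  exact ⟨x, hKsub hxK, hxz⟩

/-- **(T2) THICKNESS TRANSFERS FORWARD ALONG PERIOD-COMPATIBLE MORPHISMS** (the algebraic form: `φ : S″ ⟶ 𝓜_ℂ` ANY morphism of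
`ℂ`-schemes — the isogeny-quotient map `q` of the Hecke link; `AlgPoints.map φ` is continuous ★ `AlgPoints.continuous_map`).
[cite: LangeBirkenhake1992, Ch. 8 §8.1] [cite: Lange2023AbelianVarietiesComplex, §3.1.2 Prop. 3.1.4] -/
theorem isThickAt_of_periodCompatible (hF : lan2013_siegelFineModuliScheme)
    (hg : 0 < g) (hδ : IsPolarizationType δ) (hN : 3 ≤ N) (hδ' : IsPolarizationType δ')
    (𝓜 : SiegelFineModuliScheme g N δ) (𝓜' : SiegelFineModuliScheme g N' δ')
    {S'' : SchemeOver ℂ} (ι' : S'' ⟶ (Motives.baseChange ℚ ℂ).obj 𝓜'.M)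
    (d'' : ℕ) [SmoothOfRelativeDimension d'' S''.hom] (s₀ : ComplexPoints S'')
    (r' : gspFinAdelic δ') (hthick : IsThickAtWith hδ' 𝓜' ι' d'' s₀ r')
    (φ : S'' ⟶ (Motives.baseChange ℚ ℂ).obj 𝓜.M)
    (θ : siegelUpperHalfSpace g → siegelUpperHalfSpace g) (hθo : IsOpenMap θ)
    (r : gspFinAdelic δ) (hr : r ∈ principalLevelSubgroup δ 1)
    (hcompat :
      haveI : IsLocallyNoetherian (specOver ℚ ℂ).left := inferInstanceAs (IsLocallyNoetherian (Spec (CommRingCat.of ℂ)))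
      ∀ (s : ComplexPoints S'') (Z : siegelUpperHalfSpace g)
        (P' : PolarizedAbelianSchemeWithLevel g N' δ' (specOver ℚ ℂ).left),
        IsAdmissibleAt hδ' r' Z.1 Z.2 P' →
        AlgPoints.baseChangeEquiv (algebraMap ℚ ℂ) 𝓜'.M (𝓜'.classifyingMap (specOver ℚ ℂ) P') = AlgPoints.map (L := ℂ) ι' s →
        ∃ P : PolarizedAbelianSchemeWithLevel g N δ (specOver ℚ ℂ).left,
          IsAdmissibleAt hδ r (θ Z).1 (θ Z).2 P ∧
          AlgPoints.baseChangeEquiv (algebraMap ℚ ℂ) 𝓜.M (𝓜.classifyingMap (specOver ℚ ℂ) P) = AlgPoints.map (L := ℂ) φ s)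
    {S' : SchemeOver ℂ} (ι : S' ⟶ (Motives.baseChange ℚ ℂ).obj 𝓜.M) [IsOpenImmersion ι.left]
    (d : ℕ) [SmoothOfRelativeDimension d S'.hom] (t : ComplexPoints S')
    (ht : AlgPoints.map (L := ℂ) ι t = AlgPoints.map (L := ℂ) φ s₀) :
    IsThickAt hδ 𝓜 ι d t :=
  isThickAt_of_periodCompatible_of_continuous hF hg hδ hN hδ' 𝓜 𝓜' ι' d'' s₀ r' hthick (AlgPoints.map (L := ℂ) φ)
    (Literature.AlgebraicGeometry.Motives.AlgPoints.continuous_map φ) θ hθo r hr hcompat ι d t ht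

end EquidimThickTransfer

end Summit.HodgeConjecture.HodgeConjecture.Theorems

end
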